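import Literature.MathematicalPhysics.QuantumFieldTheory.Balaban1983to89.BlockAveraging
import HarnessLib

/-!
# `Balaban1983to89.BlockAveragingSection` — every coarse configuration IS a block average: an explicit SECTION of Bałaban's
# (0.4) averaging `U ↦ Ū` ([Balaban1987RG1] (0.3)–(0.4)), for every small-loop average `ℰ` with `ℰ(1,…,1) = 1`

Cell `ym3-torus` (HUMAN RULING D-0037, YM ladder rung R3), seat `ym3-torus-p1` gen 4; gap G-K1a-4 of the cell record
HOME/UV3-NODE.md §11 (the fibres `{U : D_{n,K}U = V}` of `T3ConstrainedMinimiser` are NONEMPTY, so its `minAction` is a genuine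
constrained minimum and `T3DescentFibreTower.minAction_tower` holds unconditionally).  Elementary lattice geometry; nothing here is
an estimate.

THE SECTION.  For a coarse configuration `V` on `T^{(j+1)}` put `faceSec V (b) := V(c)` if the fine bond `b = ⟨x, x+e_μ⟩` EXITS ITS
BLOCK (`x` is at the last position of `B(blockOf x)` in direction `μ`, i.e. `b` crosses the face between `B(y)` and `B(y+e_μ)`,
`y = blockOf x`; then `c = ⟨y, y+e_μ⟩`), and `faceSec V (b) := 1` otherwise (§1).  Then (standing range `j + 1 ≤ m + K`):
* §2 the straight transporter `U(c)` of (0.4) (`AveragingRT.axialAvg`, `L` steps from the centre of `B(c₋)`) meets exactly one exiting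
  bond, the one at offset `(L−1)/2`, so `axialAvg (faceSec V) = V` (`axialAvg_faceSec`);
* §3 every loop `Γ ∪ [x,x′] ∪ (−Γ′) ∪ (−c)` of (0.4) (`BlockAveraging.loopHol`) crosses the face of `c` exactly once each way and no
  other face: on its bonds `faceSec V` coincides with the PURE GAUGE `u(z) = V(c)⁻¹ [z ∈ B(c₊)]`, so every loop variable is `1`
  (`loopHol_faceSec`; prefix-box bookkeeping `netDisp_take_loopWord` + `blockOf_eq_of_near_emb` of `BlockAveraging`);
* §4 hence the loop family is in the small-field domain, the correction factor of (0.4) is `ℰ(1,…,1)`, and for every `ℰ` with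
  `ℰ.E (1,…,1) = 1` (the printed `exp[mean log]`, `LoopAverage.trivial`) **`avgFun ℰ (faceSec V) = V`** (`avgFun_faceSec`):
  `(blockAvg ℰ).avg` is SURJECTIVE with the explicit right inverse `faceSec` (`blockAvg_faceSec`, `surjective_blockAvg`).

References: T. Bałaban, CMP 109 (1987) 249 [Balaban1987RG1] ((0.3)–(0.4) p.252–253); CMP 98 (1985) 17 [Balaban1985Averaging]
((3), (9) p.18–19: bonds, transporters); CMP 95 (1984) 17 [Balaban1984PropagatorsI] ((1.7) p.18: the straight contours).
-/

noncomputable section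

namespace Literature.MathematicalPhysics.QuantumFieldTheory.Balaban1983to89.BlockAveragingSection

open T4Continuum AveragingRT BlockAveraging

variable {P : Params} {j : ℕ} {G : Type*} [GaugeGroup G]

/-! ## §1 The face section -/

/-- The fine bond `b = ⟨x, x + e_μ⟩` EXITS ITS BLOCK: the label of `x` in direction `μ` is the last one of its block
(`≡ L − 1 (mod L)`), i.e. `b` crosses the face between `B(blockOf x)` and `B(blockOf x + e_μ)`. [cite: Balaban1987RG1, (0.3) p.252] -/
def ExitsBlock (b : PBond P j) : Prop := (b.src b.dir).val % P.L = P.L - 1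

/-- `ExitsBlock` is decidable (an equality of natural numbers). [cite: Balaban1987RG1, (0.3) p.252] -/
instance instDecidableExitsBlock (b : PBond P j) : Decidable (ExitsBlock b) := inferInstanceAs (Decidable (_ = _))

/-- **THE FACE SECTION** of the block averaging: the coarse bond variable `V(⟨blockOf x, μ⟩)` on every fine bond `⟨x, x+e_μ⟩`
exiting its block, `1` on all other bonds. [cite: Balaban1987RG1, (0.4) p.253] -/
def faceSec (V : GaugeField P (j+1) G) : GaugeField P j G :=
  fun b => if ExitsBlock b then V ⟨blockOf b.src, b.dir⟩ else 1

/-- Value on an exiting bond. [cite: Balaban1987RG1, (0.4) p.253] -/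
theorem faceSec_of_exits (V : GaugeField P (j+1) G) {b : PBond P j} (h : ExitsBlock b) :
    faceSec V b = V ⟨blockOf b.src, b.dir⟩ := if_pos h

/-- Value on a non-exiting bond. [cite: Balaban1987RG1, (0.4) p.253] -/
theorem faceSec_of_not_exits (V : GaugeField P (j+1) G) {b : PBond P j} (h : ¬ ExitsBlock b) : faceSec V b = 1 := if_neg h

/-! ### centred coordinates: block and in-block offset of a site near a block centre -/

/-- A fine site displaced by `e`, `|e_ν| ≤ (L−1)/2`, from the centre `emb y` is the block site of `B(y)` with offsets
`(L−1)/2 + e_ν` (standing range; the computation inside `BlockAveraging.blockOf_eq_of_near_emb`). [cite: Balaban1987RG1, (0.3) p.252] -/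
theorem eq_blockSite_of_near_emb (hj : j + 1 ≤ P.m + P.K) (y : Site P (j+1)) (s : Site P j) (e : Fin P.d → ℤ)
    (hs : ∀ ν, s ν = emb y ν + ((e ν : ℤ) : ZMod (P.sitesPerDir j)))
    (he : ∀ ν, -(((P.L - 1) / 2 : ℕ) : ℤ) ≤ e ν ∧ e ν ≤ (((P.L - 1) / 2 : ℕ) : ℤ)) :
    s = Site.blockSite y (fun ν => ⟨((((P.L - 1) / 2 : ℕ) : ℤ) + e ν).toNat, by
      have := he ν; have := AveragingRT.two_mul_half_add_one P; omega⟩) := by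
  have _ := hj
  set h : ℕ := (P.L - 1) / 2 with hh
  funext ν
  have h0 : 0 ≤ (h : ℤ) + e ν := by have := he ν; omega
  rw [hs ν]
  show (((y ν).val * P.L + (P.L - 1) / 2 : ℕ) : ZMod (P.sitesPerDir j)) + ((e ν : ℤ) : ZMod (P.sitesPerDir j)) =
    (((y ν).val * P.L + ((h : ℤ) + e ν).toNat : ℕ) : ZMod (P.sitesPerDir j))
  rw [← hh, ← Int.cast_natCast (R := ZMod (P.sitesPerDir j)) ((y ν).val * P.L + h), ← Int.cast_add,
    ← Int.cast_natCast (R := ZMod (P.sitesPerDir j)) ((y ν).val * P.L + ((h : ℤ) + e ν).toNat)]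
  congr 1
  push_cast
  rw [Int.toNat_of_nonneg h0]
  ring

/-- In-block offset of such a site in direction `ν`: `(s ν).val mod L = (L−1)/2 + e_ν`. [cite: Balaban1987RG1, (0.3) p.252] -/
theorem val_mod_of_near_emb (hj : j + 1 ≤ P.m + P.K) (y : Site P (j+1)) (s : Site P j) (e : Fin P.d → ℤ)
    (hs : ∀ ν, s ν = emb y ν + ((e ν : ℤ) : ZMod (P.sitesPerDir j)))
    (he : ∀ ν, -(((P.L - 1) / 2 : ℕ) : ℤ) ≤ e ν ∧ e ν ≤ (((P.L - 1) / 2 : ℕ) : ℤ)) (ν : Fin P.d) :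
    (((s ν).val % P.L : ℕ) : ℤ) = (((P.L - 1) / 2 : ℕ) : ℤ) + e ν := by
  have h0 : 0 ≤ (((P.L - 1) / 2 : ℕ) : ℤ) + e ν := by have := he ν; omega
  have hlt : ((((P.L - 1) / 2 : ℕ) : ℤ) + e ν).toNat < P.L := by
    have := he ν; have := AveragingRT.two_mul_half_add_one P; omega
  rw [eq_blockSite_of_near_emb hj y s e hs he, Site.val_blockSite hj, Nat.mul_add_mod', Nat.mod_eq_of_lt hlt,
    Int.toNat_of_nonneg h0]

/-! ## §2 The straight transporter of the section is `V(c)` -/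

/-- In-block offset, in the direction of `c`, of the `t`-th site of the line of `c`: `(L−1)/2 + t` on the first half
(`t ≤ (L−1)/2`, block `B(c₋)`), `t − (L+1)/2` on the second (`(L−1)/2 < t ≤ L`, block `B(c₊)`). [cite: Balaban1984PropagatorsI, (1.7) p.18] -/
theorem val_lineSite_mod (hj : j + 1 ≤ P.m + P.K) (c : PBond P (j+1)) {t : ℕ} (ht : t < P.L) :
    ((lineSite c t) c.dir).val % P.L = if t ≤ (P.L - 1) / 2 then (P.L - 1) / 2 + t else t - (P.L + 1) / 2 := by
  have hL := P.hL.2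
  by_cases hlo : t ≤ (P.L - 1) / 2
  · rw [if_pos hlo, lineSite_eq_lo hj c hlo, Site.val_blockSite hj, Nat.mul_add_mod']
    simp only [offLo, if_true]
    exact Nat.mod_eq_of_lt (by omega)
  · rw [if_neg hlo, lineSite_eq_hi hj c (lt_of_not_ge hlo) ht.le, Site.val_blockSite hj, Nat.mul_add_mod']
    simp only [offHi, if_true]
    exact Nat.mod_eq_of_lt (by omega)

/-- The `t`-th bond of the line of `c` exits its block iff `t = (L−1)/2`. [cite: Balaban1984PropagatorsI, (1.7) p.18] -/
theorem exitsBlock_line_iff (hj : j + 1 ≤ P.m + P.K) (c : PBond P (j+1)) {t : ℕ} (ht : t < P.L) :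
    ExitsBlock (line c t) ↔ t = (P.L - 1) / 2 := by
  have hL := P.hL.2
  obtain ⟨k, hk⟩ := P.hL.1
  show ((lineSite c t) c.dir).val % P.L = P.L - 1 ↔ _
  rw [val_lineSite_mod hj c ht]
  split_ifs with hlo <;> omega

/-- Partial transporters of the section along the line of `c`: `1` up to the exiting bond, `V(c)` from there on. [cite: Balaban1984PropagatorsI, (1.7) p.18] -/
theorem pathProd_faceSec (hj : j + 1 ≤ P.m + P.K) (V : GaugeField P (j+1) G) (c : PBond P (j+1)) :
    ∀ n : ℕ, n ≤ P.L → pathProd (faceSec V) c n = if (P.L - 1) / 2 < n then V c else 1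
  | 0, _ => by simp [pathProd]
  | n + 1, hn => by
    have hn' : n < P.L := hn
    rw [pathProd, pathProd_faceSec hj V c n hn'.le]
    by_cases hlt : n < (P.L - 1) / 2
    · rw [if_neg (by omega), if_neg (by omega), faceSec_of_not_exits V ((exitsBlock_line_iff hj c hn').not.mpr (by omega)),
        one_mul]
    · by_cases heq : n = (P.L - 1) / 2
      · rw [if_neg (by omega), if_pos (by omega), faceSec_of_exits V ((exitsBlock_line_iff hj c hn').mpr heq), one_mul]
        show V ⟨blockOf (lineSite c n), c.dir⟩ = V c
        rw [lineSite_eq_lo hj c heq.le, Site.blockOf_blockSite hj]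
      · rw [if_pos (by omega), if_pos (by omega), faceSec_of_not_exits V ((exitsBlock_line_iff hj c hn').not.mpr heq),
          mul_one]

/-- **`U(c) = V(c)` FOR THE SECTION**: the straight transporter of `faceSec V` along the line of `c` is `V(c)`. [cite: Balaban1984PropagatorsI, (1.7) p.18] -/
theorem axialAvg_faceSec (hj : j + 1 ≤ P.m + P.K) (V : GaugeField P (j+1) G) : axialAvg (faceSec V) = V := by
  funext c
  show pathProd (faceSec V) c P.L = V c
  rw [pathProd_faceSec hj V c P.L le_rfl, if_pos (half_lt P)]

/-! ## §3 Every loop variable of (0.4) of the section is `1` -/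

/-- Steps of a walk join consecutive prefix ends: the source of every step is the end of some prefix, and the displacement of
its target (the end of the neighbouring prefix) is the source's plus the unit vector of the bond's direction. [cite: Balaban1987RG1, (0.4) p.253] -/
theorem exists_take_of_mem_walk : ∀ (x : Site P j) (w : List (Letter P.d)) (s : LStep P j), s ∈ walk x w →
    ∃ k₁ k₂, s.bond.src = walkEnd x (w.take k₁) ∧
      ∀ κ, netDisp (w.take k₂) κ = netDisp (w.take k₁) κ + if κ = s.bond.dir then 1 else 0
  | _, [], s, hs => by simp [walk] at hs
  | x, (μ, true) :: w, s, hs => by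
    simp only [walk, List.mem_cons] at hs
    rcases hs with rfl | hs
    · refine ⟨0, 1, rfl, fun κ => ?_⟩
      show netDisp [(μ, true)] κ = netDisp [] κ + _
      by_cases hκ : κ = μ
      · subst hκ; simp [netDisp]
      · simp [netDisp, hκ, Ne.symm hκ]
    · obtain ⟨k₁, k₂, h1, h2⟩ := exists_take_of_mem_walk (x.shift μ) w s hs
      refine ⟨k₁ + 1, k₂ + 1, by rw [List.take_succ_cons]; exact h1, fun κ => ?_⟩
      rw [List.take_succ_cons, List.take_succ_cons, netDisp_cons, netDisp_cons, h2 κ]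
      ring
  | x, (μ, false) :: w, s, hs => by
    simp only [walk, List.mem_cons] at hs
    rcases hs with rfl | hs
    · refine ⟨1, 0, rfl, fun κ => ?_⟩
      show netDisp [] κ = netDisp [(μ, false)] κ + _
      by_cases hκ : κ = μ
      · subst hκ; simp [netDisp]
      · simp [netDisp, hκ, Ne.symm hκ]
    · obtain ⟨k₁, k₂, h1, h2⟩ := exists_take_of_mem_walk (x.unshift μ) w s hs
      refine ⟨k₁ + 1, k₂ + 1, by rw [List.take_succ_cons]; exact h1, fun κ => ?_⟩
      rw [List.take_succ_cons, List.take_succ_cons, netDisp_cons, netDisp_cons, h2 κ]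
      ring

/-- Centred coordinates relative to `c₊` from those relative to `c₋`: `emb c₊ = emb c₋ + L e_μ`. [cite: Balaban1987RG1, (0.3) p.252] -/
theorem near_tgt_of_near_src (c : PBond P (j+1)) (s : Site P j) (f : Fin P.d → ℤ)
    (hs : ∀ ν, s ν = emb c.src ν + ((f ν : ℤ) : ZMod (P.sitesPerDir j))) (ν : Fin P.d) :
    s ν = emb c.tgt ν + (((f ν - if ν = c.dir then (P.L : ℤ) else 0 : ℤ)) : ZMod (P.sitesPerDir j)) := by
  rw [hs ν, PBond.tgt, emb_shift_apply]
  by_cases hν : ν = c.dir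
  · rw [if_pos hν, if_pos hν]; push_cast; ring
  · rw [if_neg hν, if_neg hν]; push_cast; ring

/-- `c₋ ≠ c₊` (every torus of the tree has at least two sites per direction). [cite: Balaban1987RG1, (0.1) p.251] -/
theorem src_ne_tgt (c : PBond P (j+1)) : c.src ≠ c.tgt := by
  intro h
  have h1 := congrFun h c.dir
  rw [PBond.tgt, Site.shift_apply, if_pos rfl] at h1
  have h2 : (1 : ZMod (P.sitesPerDir (j+1))) = 0 := by
    have := congrArg (fun z => z - c.src c.dir) h1
    simpa using this.symm
  exact one_ne_zero h2

/-- THE PURE GAUGE CONCENTRATED ON `B(c₊)`: `u(z) = V(c)⁻¹` for `z ∈ B(c₊)`, `1` elsewhere. [cite: Balaban1985Averaging, (8) p.19] -/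
def faceGauge (V : GaugeField P (j+1) G) (c : PBond P (j+1)) : GaugeTransf P j G :=
  fun z => if blockOf z = c.tgt then (V c)⁻¹ else 1

/-- **ON THE BONDS OF EVERY LOOP `Γ ∪ [x,x′] ∪ (−Γ′) ∪ (−c)` OF (0.4), THE SECTION IS THE PURE GAUGE `faceGauge V c`**: a bond
of the loop exits its block iff it crosses the face of `c` (from `B(c₋)` to `B(c₊)`, in the direction of `c`); every other bond of
the loop stays in its block (standing range; prefix box `netDisp_take_loopWord`). [cite: Balaban1987RG1, (0.4) p.253] -/
theorem faceSec_eq_gaugeAct_of_mem_loop (hj : j + 1 ≤ P.m + P.K) (V : GaugeField P (j+1) G) (c : PBond P (j+1)) (i : Idx P)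
    (s : LStep P j) (hs : s ∈ walk (emb c.src) (loopWord P.L c.dir (off i.1) i.2.1 i.2.2)) :
    faceSec V s.bond = GaugeField.gaugeAct (faceGauge V c) 1 s.bond := by
  have hL := AveragingRT.two_mul_half_add_one P
  have hL1 := P.hL.2
  obtain ⟨k₁, k₂, hsrc, hdisp⟩ := exists_take_of_mem_walk _ _ s hs
  set h : ℕ := (P.L - 1) / 2 with hh
  set μ := c.dir with hμ
  set d := s.bond.dir with hd
  set e : Fin P.d → ℤ := fun κ => netDisp ((loopWord P.L c.dir (off i.1) i.2.1 i.2.2).take k₁) κ with he_def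
  -- the prefix box, for the source and for the target displacement
  have hb : ∀ κ, -(h : ℤ) ≤ e κ ∧ e κ ≤ (if μ = κ then (P.L : ℤ) else 0) + h := fun κ =>
    netDisp_take_loopWord (L := P.L) (h := h) c.dir (off i.1) (off_bounds i.1) i.2.1 i.2.2 k₁ κ
  have hb' : ∀ κ, -(h : ℤ) ≤ e κ + (if κ = d then 1 else 0) ∧
      e κ + (if κ = d then 1 else 0) ≤ (if μ = κ then (P.L : ℤ) else 0) + h := fun κ => by
    have := netDisp_take_loopWord (L := P.L) (h := h) c.dir (off i.1) (off_bounds i.1) i.2.1 i.2.2 k₂ κ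
    rw [hdisp κ] at this
    exact this
  -- centred coordinates of the source and the target of the bond
  have hsrcν : ∀ ν, s.bond.src ν = emb c.src ν + ((e ν : ℤ) : ZMod (P.sitesPerDir j)) := fun ν => by
    rw [hsrc, walkEnd_apply]
  have htgtν : ∀ ν, s.bond.tgt ν =
      emb c.src ν + (((e ν + if ν = d then 1 else 0 : ℤ)) : ZMod (P.sitesPerDir j)) := fun ν => by
    rw [PBond.tgt, Site.shift_apply, hsrcν, hsrcν]
    by_cases hν : ν = d
    · rw [if_pos hν, if_pos hν, hν]; push_cast; ring
    · rw [if_neg hν, if_neg hν]; push_cast; ring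
  have hsrcν' := near_tgt_of_near_src c s.bond.src e hsrcν
  have htgtν' := near_tgt_of_near_src c s.bond.tgt _ htgtν
  have hct : c.src ≠ c.tgt := src_ne_tgt c
  show (if ExitsBlock s.bond then V ⟨blockOf s.bond.src, d⟩ else 1) =
    (if blockOf s.bond.src = c.tgt then (V c)⁻¹ else 1) * 1 * (if blockOf s.bond.tgt = c.tgt then (V c)⁻¹ else 1)⁻¹
  by_cases hside : e μ ≤ h
  · -- the source lies in `B(c₋)`
    have hbox : ∀ ν, -(h : ℤ) ≤ e ν ∧ e ν ≤ h := fun ν => by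
      refine ⟨(hb ν).1, ?_⟩
      by_cases hν : μ = ν
      · rw [← hν]; exact hside
      · have := (hb ν).2; rw [if_neg hν] at this; linarith
    have hblk : blockOf s.bond.src = c.src := blockOf_eq_of_near_emb hj c.src _ e hsrcν hbox
    have hoff := val_mod_of_near_emb hj c.src _ e hsrcν hbox d
    by_cases hex : ExitsBlock s.bond
    · -- exiting: then `e_d = h`, `d = μ`, and the target lies in `B(c₊)`
      have hexv : ((s.bond.src d).val % P.L : ℕ) = P.L - 1 := hex
      have hed : e d = h := by rw [hexv] at hoff; push_cast [hL1.le] at hoff; omega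
      have hdμ : d = μ := by
        by_contra hne
        have := (hb' d).2
        rw [if_pos rfl, if_neg (Ne.symm hne)] at this
        omega
      have hbox' : ∀ ν, -(h : ℤ) ≤ (e ν + (if ν = d then 1 else 0)) - (if ν = c.dir then (P.L : ℤ) else 0) ∧
          (e ν + (if ν = d then 1 else 0)) - (if ν = c.dir then (P.L : ℤ) else 0) ≤ h := fun ν => by
        by_cases hν : ν = d
        · rw [if_pos hν, if_pos (hν.trans hdμ), hν, hed]; omega
        · rw [if_neg hν, if_neg (fun h' => hν (h'.trans hdμ.symm))]; have := hbox ν; omega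
      have hblk' : blockOf s.bond.tgt = c.tgt := blockOf_eq_of_near_emb hj c.tgt _ _ htgtν' hbox'
      rw [if_pos hex, if_neg (show ¬ blockOf s.bond.src = c.tgt by rw [hblk]; exact hct), if_pos hblk', one_mul, one_mul,
        inv_inv, hblk, hdμ]
    · -- not exiting: the target lies in `B(c₋)` as well
      have hbox' : ∀ ν, -(h : ℤ) ≤ e ν + (if ν = d then 1 else 0) ∧ e ν + (if ν = d then 1 else 0) ≤ h := fun ν => by
        refine ⟨by have := (hbox ν).1; split_ifs <;> omega, ?_⟩
        by_cases hν : ν = d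
        · rw [if_pos hν]
          by_cases hνμ : μ = ν
          · -- `ν = d = μ`: `e_d = h` would make the bond exit
            by_contra hgt
            have heq : e d = h := by have := (hbox ν).2; rw [hν] at this hgt; omega
            apply hex
            show ((s.bond.src d).val % P.L : ℕ) = P.L - 1
            have : (((s.bond.src d).val % P.L : ℕ) : ℤ) = ((P.L - 1 : ℕ) : ℤ) := by
              rw [hoff, heq]; push_cast [hL1.le]; omega
            exact_mod_cast this
          · have := (hb' ν).2; rw [if_pos hν, if_neg hνμ] at this; omega
        · rw [if_neg hν, add_zero]; exact (hbox ν).2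
      have hblk' : blockOf s.bond.tgt = c.src := blockOf_eq_of_near_emb hj c.src _ _ htgtν hbox'
      rw [if_neg hex, if_neg (show ¬ blockOf s.bond.src = c.tgt by rw [hblk]; exact hct),
        if_neg (show ¬ blockOf s.bond.tgt = c.tgt by rw [hblk']; exact hct), inv_one, mul_one, mul_one]
  · -- the source lies in `B(c₊)`; such a bond never exits its block, and its target lies in `B(c₊)` too
    rw [not_le] at hside
    have hbox : ∀ ν, -(h : ℤ) ≤ e ν - (if ν = c.dir then (P.L : ℤ) else 0) ∧
        e ν - (if ν = c.dir then (P.L : ℤ) else 0) ≤ h := fun ν => by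
      by_cases hν : ν = c.dir
      · rw [if_pos hν, hν, ← hμ]; have := (hb μ).2; rw [if_pos rfl] at this; omega
      · rw [if_neg hν, sub_zero]; have := hb ν; rw [if_neg (Ne.symm hν)] at this; omega
    have hblk : blockOf s.bond.src = c.tgt := blockOf_eq_of_near_emb hj c.tgt _ _ hsrcν' hbox
    have hoff := val_mod_of_near_emb hj c.tgt _ _ hsrcν' hbox d
    have hnex : ¬ ExitsBlock s.bond := by
      intro hex
      have hexv : ((s.bond.src d).val % P.L : ℕ) = P.L - 1 := hex
      rw [hexv] at hoff
      push_cast [hL1.le] at hoff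
      have := (hb' d).2
      rw [if_pos rfl] at this
      by_cases hdc : d = c.dir
      · rw [if_pos hdc] at hoff; rw [hμ, if_pos hdc.symm] at this; omega
      · rw [if_neg hdc] at hoff; rw [hμ, if_neg (Ne.symm hdc)] at this; omega
    have hbox' : ∀ ν, -(h : ℤ) ≤ (e ν + (if ν = d then 1 else 0)) - (if ν = c.dir then (P.L : ℤ) else 0) ∧
        (e ν + (if ν = d then 1 else 0)) - (if ν = c.dir then (P.L : ℤ) else 0) ≤ h := fun ν => by
      refine ⟨by have := (hbox ν).1; split_ifs at this ⊢ <;> omega, ?_⟩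
      by_cases hν : ν = d
      · rw [if_pos hν]
        have := (hb' ν).2
        rw [if_pos hν] at this
        by_cases hνc : ν = c.dir
        · rw [if_pos hνc]; rw [hμ, if_pos hνc.symm] at this; omega
        · rw [if_neg hνc]; rw [hμ, if_neg (Ne.symm hνc)] at this; omega
      · rw [if_neg hν, add_zero]; exact (hbox ν).2
    have hblk' : blockOf s.bond.tgt = c.tgt := blockOf_eq_of_near_emb hj c.tgt _ _ htgtν' hbox'
    rw [if_neg hnex, if_pos hblk, if_pos hblk']
    group

/-- Holonomies of the trivial configuration are trivial (local copy of `T3DescentFibreTower.holAt_one`). [cite: Balaban1985Averaging, (9) p.19] -/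
private theorem holAt_one' (γ : List (LStep P j)) : holAt (1 : GaugeField P j G) γ = 1 := by
  induction γ with
  | nil => exact holAt_nil _
  | cons s γ ih =>
    rw [holAt_cons, ih, mul_one]
    show (if s.fwd then (1 : G) else (1 : G)⁻¹) = 1
    rw [inv_one]
    split_ifs <;> rfl

/-- **EVERY LOOP VARIABLE OF (0.4) OF THE SECTION IS `1`**: `U(Γ ∪ [x,x′] ∪ (−Γ′) ∪ (−c)) = 1` for `U = faceSec V`, every `c`, every
index `(x, Γ, Γ′)` (standing range). [cite: Balaban1987RG1, (0.4) p.253] -/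
theorem loopHol_faceSec (hj : j + 1 ≤ P.m + P.K) (V : GaugeField P (j+1) G) (c : PBond P (j+1)) (i : Idx P) :
    loopHol (faceSec V) c i = 1 := by
  unfold loopHol
  rw [T4ReflectionCone.holAt_congr (fun s hs => faceSec_eq_gaugeAct_of_mem_loop hj V c i s hs), holAt_gaugeAct_walk,
    holAt_one', mul_one, walkEnd_eq_self_of_netDisp (fun ν => by rw [netDisp_loopWord]; simp), mul_inv_cancel]

/-! ## §4 The block averaging of the section is the identity: `Ū = V` for `U = faceSec V` -/

/-- The section is in the small-field domain of (0.4) at every coarse bond. [cite: Balaban1987RG1, (0.4) p.253] -/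
theorem small_faceSec (hj : j + 1 ≤ P.m + P.K) (ℰ : LoopAverage G) (V : GaugeField P (j+1) G) (c : PBond P (j+1)) :
    Small ℰ (faceSec V) c := fun i => by
  rw [loopHol_faceSec hj, GaugeGroup.dist1_one]; exact ℰ.δ_pos

/-- **`avgFun ℰ (faceSec V) = V`**: the (0.4) block average of the face section of `V` is `V`, for every small-loop average with
`ℰ(1,…,1) = 1` (standing range `j + 1 ≤ m + K`). [cite: Balaban1987RG1, (0.4) p.253] -/
theorem avgFun_faceSec (hj : j + 1 ≤ P.m + P.K) (ℰ : LoopAverage G) (hE : ∀ n : ℕ, ℰ.E (fun _ : Fin (n + 1) => (1 : G)) = 1)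
    (V : GaugeField P (j+1) G) : avgFun ℰ (faceSec V) = V := by
  funext c
  show corr ℰ (faceSec V) c * axialAvg (faceSec V) c = V c
  have hl : loopHol (faceSec V) c = fun _ => 1 := funext (loopHol_faceSec hj V c)
  rw [axialAvg_faceSec hj, corr, if_pos (small_faceSec hj ℰ V c), hl]
  show ℰ.avg (fun _ => (1 : G)) * V c = V c
  rw [show ℰ.avg (fun _ : Idx P => (1 : G)) = 1 from hE _, one_mul]

/-- The same for the `Averaging` structure `blockAvg ℰ`. [cite: Balaban1987RG1, (0.4) p.253] -/
theorem blockAvg_faceSec (hj : j + 1 ≤ P.m + P.K) (ℰ : LoopAverage G) (hE : ∀ n : ℕ, ℰ.E (fun _ : Fin (n + 1) => (1 : G)) = 1)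
    (V : GaugeField P (j+1) G) : (blockAvg ℰ).avg (faceSec V) = V := by
  rw [blockAvg_avg]; exact avgFun_faceSec hj ℰ hE V

/-- **BAŁABAN'S BLOCK AVERAGING IS SURJECTIVE**: every configuration on `T^{(j+1)}` is the (0.4) average of a configuration on
`T^{(j)}` (standing range; every `ℰ` with `ℰ(1,…,1) = 1`). [cite: Balaban1987RG1, (0.4) p.253] -/
theorem surjective_blockAvg (hj : j + 1 ≤ P.m + P.K) (ℰ : LoopAverage G)
    (hE : ∀ n : ℕ, ℰ.E (fun _ : Fin (n + 1) => (1 : G)) = 1) :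
    Function.Surjective (blockAvg (P := P) (j := j) ℰ).avg :=
  fun V => ⟨faceSec V, blockAvg_faceSec hj ℰ hE V⟩

/-- With the trivial small-loop average (axial averaging) the hypothesis is `rfl`. [cite: Balaban1984PropagatorsI, (1.7) p.18] -/
theorem surjective_blockAvg_trivial (hj : j + 1 ≤ P.m + P.K) :
    Function.Surjective (blockAvg (P := P) (j := j) (LoopAverage.trivial G)).avg :=
  surjective_blockAvg hj _ fun _ => rfl

end Literature.MathematicalPhysics.QuantumFieldTheory.Balaban1983to89.BlockAveragingSection

end
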